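import Summits.ResolutionOfSingularities.ResolutionOfSingularities.Theorems.FrobeniusClosingSteerThreadChainLemmas
import Summits.ResolutionOfSingularities.ResolutionOfSingularities.Theorems.FrobeniusClosingSteerNoSingularCarrierStep
import Summits.ResolutionOfSingularities.ResolutionOfSingularities.Theorems.FrobeniusClosingSteerNoHeightOneCarrierTwoAlgebra
import Summits.ResolutionOfSingularities.ResolutionOfSingularities.Theorems.FrobeniusClosingSteerGeoDictShorts
import HarnessLib

/-!
# Stripped threads, part 1: divisor steps, the germ off the exceptional prime, and localisation bookkeeping

W4.1, crux `Steer` (stmt-ResolutionOfSingularities-16345), σ-line, §σ2.25 v2.1 piece F-A3 `StrippedThreadTwoN`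
(res-L0-w41-plan-1 RULINGS 25/25′/27a/30a; Θ1♭ packaging theorem, OWNER res-D-pv-003 by RULING 36; CONSULT res-D-pv-011 AS
res-L0-w41-stub-7, whose thread-chain files p514807 / p515983 are the template). Theses-free, def-free. Along an eternal σ_top-steered
run a thread of height `c ≥ 2` may be HIT for ever by height-ONE centres — the strippings of the fresh exceptional divisors of its
own visits. This file supplies the bookkeeping for such DIVISOR STEPS and for the comparison of germs, in the def-free `locChar`
interface of `FrobeniusClosingSteerGeoDictQuadratic.lean` (`hT : ∀ z, z ∈ T ↔ ∃ a b : R, b ∉ W ∧ z = a / b`, «`T = R_W` inside `K`»):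

* `ne_bot_of_isLocalBlowupAlong` — the centre of a local blowing up is never `⊥` (it contains the non-zero chart element), so
  every hit has height `≥ 1`;
* `eq_locAtCentre_of_divisorStep`, `excParam_eq_mul_of_divisorStep` — a step along a HEIGHT-ONE prime `P = (π)` of a regular member
  `R = R_{𝔪_O ∩ R}` (principal: regular local rings are factorial, tree `NoHeightOneCarrier.exists_eq_span_singleton_of_height_eq_one`)
  does not change the member (`R' = R_{𝔪_O ∩ R} = R`, tree `NoSingularCarrier.eq_of_isLocalBlowupAlong_span_singleton`) and its
  exceptional parameter is `x = π · a` with `a` a UNIT of `R` (it has the minimal value `v(π)` on `P`);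
* `locChar_sub` / `mem_comapMax_iff` / `locChar_of_locChar_le` — localisation of a localisation inside `K`: for `R_P ⊆ K` and an
  intermediate ring `R ≤ T ≤ R_P`, the prime `𝔮 = 𝔪_{R_P} ∩ T` recovers `R_P = T_𝔮`;
* `locChar_eq_of_not_mem_excPrime` — **a local blowing up is an isomorphism OFF the exceptional prime**: for the step `R → R'` along
  `P` with exceptional parameter `x` and a prime `Q₁` of `R'` with `x ∉ Q₁`, `(R')_{Q₁} = R_{Q₁ ∩ R}` inside `K` (chart elements are
  `γ / x^N`, and `x` is a unit at `Q₁`).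

Part 2 (`…StrippedThreadDivisor`) proves the identification «a height-one hit of the thread strips the fresh exceptional divisor:
its parameter is `ξ · unit` in the germ»; part 3 (`…StrippedThreadChain`) assembles the eternal isolated STRIPPED radicand chain
(`NoEternalStrippedRadicandChain p c` violated). OURS (the W4.1 engine); standard commutative algebra.
[cite: NovacoskiSpivakovsky2014, Def. 2.8, Def. 2.11] [cite: Matsumura1987, Thm. 20.3] [cite: Cutkosky2014, §2.1]
-/

noncomputable section

-- `Summit.<S>.<S>.…` duplicates the summit name by design (single-problem summit).
set_option linter.dupNamespace false

open Polynomial IsLocalRing Literature.AlgebraicGeometry.Resolution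

namespace Summit.ResolutionOfSingularities.ResolutionOfSingularities.Theorems.SwitchingDichotomy.StrippedThread

variable {K : Type} [Field K]

/-! ## §1 The centre of a local blowing up is not `⊥` -/

/-- **The centre of a local blowing up is not the zero ideal**: its generating set contains the non-zero chart element.
[cite: NovacoskiSpivakovsky2014, Def. 2.11] -/
theorem ne_bot_of_isLocalBlowupAlong {O : ValuationSubring K} {B B' : Subring K} {I : Ideal B}
    (h : IsLocalBlowupAlong O B I B') : I ≠ ⊥ := by
  obtain ⟨-, u, u₀, hu, hu₀, h0, -, -⟩ := h
  intro hI
  apply h0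
  have : (u₀ : B) ∈ I := hu ▸ Ideal.subset_span (Finset.mem_coe.mpr hu₀)
  rw [hI] at this
  exact (Submodule.mem_bot _).mp this

/-- Hence a prime centre of height `≤ 1` in a domain has height EXACTLY `1`. [folklore] -/
theorem height_eq_one_of_isLocalBlowupAlong {O : ValuationSubring K} {B B' : Subring K} {I : Ideal B}
    (h : IsLocalBlowupAlong O B I B') (hle : I.height ≤ 1) : I.height = 1 := by
  refine le_antisymm hle ?_
  rw [Order.one_le_iff_ne_zero, Ne, Ideal.height_eq_zero_iff_eq_bot]
  exact ne_bot_of_isLocalBlowupAlong h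

/-! ## §2 Divisor steps: a step along a height-one centre of a regular member -/

section DivisorStep

variable {O : ValuationSubring K} {R R' : Subring K} [IsRegularLocalRing R] {P : Ideal R} [P.IsPrime]

/-- **A divisor step does not change the member.** If the regular member `R = R_{𝔪_O ∩ R}` is blown up along a prime `P` of height
one, then `R' = R_{𝔪_O ∩ R}` (`= R`): `P = (π)` is principal (regular local rings are factorial), and the local blowing up along a
principal ideal is trivial. [cite: Matsumura1987, Thm. 20.3] [cite: NovacoskiSpivakovsky2014, Def. 2.11] -/
theorem eq_locAtCentre_of_divisorStep (hloc : locAtCentre R O = R) (hP : P.height = 1)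
    (hbl : IsLocalBlowupAlong O R P R') : R' = locAtCentre R O := by
  obtain ⟨π, hPπ, -⟩ := NoHeightOneCarrier.exists_eq_span_singleton_of_height_eq_one R P hP
  subst hPπ
  rw [hloc]
  exact NoSingularCarrier.eq_of_isLocalBlowupAlong_span_singleton hloc π hbl

/-- **The exceptional parameter of a divisor step is `π · unit`.** With `R = R_{𝔪_O ∩ R}` regular, `P = (π)` of height one and `x` an
exceptional parameter along `P` (body of `IsExcParamAlong`: `x ∈ P`, `x ≠ 0`, of maximal `O`-value on `P`): `P = (π)` with `π` prime,
and `x = π · a` for a unit `a` of `R` (`π ∈ P` has value `≥ v(x)`, so `v(a) = 1` and `a⁻¹ ∈ R_{𝔪_O ∩ R} = R`).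
[cite: Matsumura1987, Thm. 20.3] [folklore] -/
theorem excParam_eq_mul_of_divisorStep (hRO : R ≤ O.toSubring) (hloc : locAtCentre R O = R) (hP : P.height = 1)
    {x : K} (hx : (∃ hxR : x ∈ R, (⟨x, hxR⟩ : R) ∈ P) ∧ x ≠ 0 ∧ ∀ y : R, y ∈ P → O.valuation (y : K) ≤ O.valuation x) :
    ∃ π : R, P = Ideal.span {π} ∧ Prime π ∧ ∃ a : K, a ∈ R ∧ a⁻¹ ∈ R ∧ x = (π : K) * a := by
  obtain ⟨⟨hxR, hxP⟩, hx0, hmax⟩ := hx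
  obtain ⟨π, hPπ, hπ⟩ := NoHeightOneCarrier.exists_eq_span_singleton_of_height_eq_one R P hP
  refine ⟨π, hPπ, hπ, ?_⟩
  have hxP' : (⟨x, hxR⟩ : R) ∈ Ideal.span {π} := hPπ ▸ hxP
  obtain ⟨a, ha⟩ := Ideal.mem_span_singleton'.mp hxP'
  have hxa : x = (π : K) * a := by
    have := congrArg (fun r : R => (r : K)) ha
    simpa [mul_comm] using this.symm
  have hπP : π ∈ P := hPπ ▸ Ideal.mem_span_singleton_self π
  have hπ0 : (π : K) ≠ 0 := by
    intro h
    apply hx0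
    rw [hxa, h, zero_mul]
  -- `v(a) = 1`
  have hva : O.valuation (a : K) = 1 := by
    have h1 := hmax π hπP
    rw [hxa, map_mul] at h1
    have hvπ0 : O.valuation (π : K) ≠ 0 := (_root_.map_ne_zero _).mpr hπ0
    have hle1 : O.valuation (a : K) ≤ 1 := (O.valuation_le_one_iff _).mpr (hRO a.2)
    refine le_antisymm hle1 ?_
    by_contra hlt
    rw [not_le] at hlt
    have : O.valuation (π : K) * O.valuation (a : K) < O.valuation (π : K) * 1 :=
      mul_lt_mul_of_pos_left hlt (zero_lt_iff.mpr hvπ0)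
    rw [mul_one] at this
    exact not_le.mpr this h1
  refine ⟨a, a.2, ?_, hxa⟩
  have h := inv_mem_locAtCentre (le_locAtCentre R O a.2) hva
  rwa [hloc] at h

end DivisorStep

/-! ## §3 Localisation of a localisation inside `K` -/

section LocLoc

variable {R T D : Subring K} {P : Ideal R} [hP : P.IsPrime]
  (hD : ∀ z : K, z ∈ D ↔ ∃ a b : R, b ∉ P ∧ z = (a : K) / b) (hRT : R ≤ T) (hTD : T ≤ D)
include hD

/-- The prime `𝔮 = 𝔪_{R_P} ∩ T` of an intermediate ring `R ≤ T ≤ R_P`, as an ideal of `T` (the comap of the maximal ideal).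
Membership: `t ∈ 𝔮 ↔ t = a / b` with `a ∈ P`, `b ∉ P`. [folklore] -/
theorem mem_comap_maximalIdeal_iff_of_locChar [IsLocalRing D] (t : T) :
    t ∈ (maximalIdeal D).comap (Subring.inclusion hTD) ↔ ∃ a b : R, a ∈ P ∧ b ∉ P ∧ (t : K) = (a : K) / b := by
  rw [Ideal.mem_comap, GeoDict.mem_maximalIdeal_iff_of_locChar hD]
  rfl

include hRT in
/-- For `r ∈ R`: `r ∈ 𝔪_{R_P} ∩ T ↔ r ∈ P`. [folklore] -/
theorem inclusion_mem_comap_maximalIdeal_iff_of_locChar [IsLocalRing D] (r : R) :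
    Subring.inclusion hRT r ∈ (maximalIdeal D).comap (Subring.inclusion hTD) ↔ r ∈ P := by
  rw [Ideal.mem_comap]
  change Subring.inclusion (hRT.trans hTD) r ∈ maximalIdeal D ↔ r ∈ P
  rw [GeoDict.mem_maximalIdeal_iff_of_locChar hD]
  constructor
  · rintro ⟨a, b, ha, hb, hab⟩
    change (r : K) = (a : K) / b at hab
    have hb0 : (b : K) ≠ 0 := GeoDict.coe_ne_zero_of_not_mem hb
    have hrb : r * b = a := by
      apply Subtype.ext
      change (r : K) * b = a
      rw [hab, div_mul_cancel₀ _ hb0]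
    have : r * b ∈ P := hrb ▸ ha
    rcases hP.mem_or_mem this with h | h
    · exact h
    · exact absurd h hb
  · intro hr
    exact ⟨r, 1, hr, fun h => hP.ne_top (P.eq_top_of_isUnit_mem h isUnit_one), by simp⟩

include hRT in
/-- **`R_P = T_𝔮`** for `R ≤ T ≤ R_P` and `𝔮 = 𝔪_{R_P} ∩ T`: the `locChar` of `D = R_P` over the intermediate ring `T`. [folklore] -/
theorem locChar_of_locChar_le [IsLocalRing D] :
    ∀ z : K, z ∈ D ↔ ∃ a b : T, b ∉ (maximalIdeal D).comap (Subring.inclusion hTD) ∧ z = (a : K) / b := by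
  intro z
  constructor
  · intro hz
    obtain ⟨a, b, hb, rfl⟩ := (hD z).mp hz
    refine ⟨Subring.inclusion hRT a, Subring.inclusion hRT b, ?_, rfl⟩
    rw [inclusion_mem_comap_maximalIdeal_iff_of_locChar hD hRT hTD]
    exact hb
  · rintro ⟨a, b, hb, rfl⟩
    rw [Ideal.mem_comap] at hb
    -- `b` is a unit of `D`
    have hbu : IsUnit (Subring.inclusion hTD b) := by
      by_contra h
      exact hb ((IsLocalRing.mem_maximalIdeal _).mpr h)
    have hbinv : ((b : K))⁻¹ ∈ D := by
      have := (isUnit_subring_iff_inv_mem _).mp hbu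
      exact this.2
    rw [div_eq_mul_inv]
    exact D.mul_mem (hTD a.2) hbinv

end LocLoc

/-! ## §4 A local blowing up is an isomorphism off the exceptional prime -/

section OffExceptional

variable {O : ValuationSubring K} {R R' : Subring K} {P : Ideal R}

/-- The local blowing up along `P` presented in the chart of ANY exceptional parameter `x` (element of `P` of maximal value):
`R' = (R[P/x])_{𝔪_O ∩ R[P/x]}` (uniqueness of the local blowing up along `P`). [cite: NovacoskiSpivakovsky2014, Lemma 2.10, Def. 2.11] -/
theorem eq_locAtCentre_chart_of_excParam (hbl : IsLocalBlowupAlong O R P R') {x : K}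
    (hx : (∃ hxR : x ∈ R, (⟨x, hxR⟩ : R) ∈ P) ∧ x ≠ 0 ∧ ∀ y : R, y ∈ P → O.valuation (y : K) ≤ O.valuation x) :
    R' = locAtCentre (Subring.closure ((R : Set K) ∪ (fun y : R => (y : K) / x) '' (P : Set R))) O := by
  haveI hdec : DecidableEq R := Classical.decEq R
  obtain ⟨⟨hxR, hxP⟩, hx0, hmax⟩ := hx
  obtain ⟨hRO, u, u₀, hu, hu₀, h0, hval, hR'⟩ := hbl
  have hbl' : IsLocalBlowupAlong O R P R' := ⟨hRO, u, u₀, hu, hu₀, h0, hval, hR'⟩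
  -- the same blowing up, presented with the generating set `insert x u` and the chart element `x`
  have hspan : Ideal.span (↑(insert (⟨x, hxR⟩ : R) u) : Set R) = P := by
    rw [Finset.coe_insert, Ideal.span_insert, hu, sup_eq_right]
    exact (Ideal.span_singleton_le_iff_mem _).mpr hxP
  have h2 : IsLocalBlowupAlong O R P
      (locAtCentre (Subring.closure ((R : Set K) ∪ (fun y : R => (y : K) / x) '' (P : Set R))) O) := by
    refine ⟨hRO, insert (⟨x, hxR⟩ : R) u, (⟨x, hxR⟩ : R), hspan, Finset.mem_insert_self _ _,
      fun h => hx0 (by simpa using congrArg Subtype.val h), ?_, ?_⟩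
    · intro y hy
      rcases Finset.mem_insert.mp hy with rfl | hy
      · exact le_rfl
      · exact hmax y (hu ▸ Ideal.subset_span (Finset.mem_coe.mpr hy))
    · rw [SteeredRun.closure_union_image_div_eq_of_span_eq R x (↑(insert (⟨x, hxR⟩ : R) u)) hspan]
  exact SteeredRun.isLocalBlowupAlong_unique hbl' h2

/-- Chart elements have bounded denominators: every element `w` of `R[P/x]` satisfies `w · x^N ∈ R` for some `N`.
(Same closure induction as the tree's `exists_pow_mul_mem_of_mem_blowupRing`.) [folklore] -/
theorem exists_pow_mul_mem_of_mem_chart {x : K} (hxR : x ∈ R) {w : K}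
    (hw : w ∈ Subring.closure ((R : Set K) ∪ (fun y : R => (y : K) / x) '' (P : Set R))) :
    ∃ (N : ℕ) (r : R), w * x ^ N = r := by
  by_cases hx0 : x = 0
  · -- degenerate chart: `y / 0 = 0`, the closure is `R`
    have hle : Subring.closure ((R : Set K) ∪ (fun y : R => (y : K) / x) '' (P : Set R)) ≤ R := by
      refine Subring.closure_le.mpr ?_
      rintro z (hz | ⟨y, -, rfl⟩)
      · exact hz
      · simp [hx0]
    exact ⟨0, ⟨w, hle hw⟩, by simp⟩
  induction hw using Subring.closure_induction with
  | mem y hy =>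
    rcases hy with hy | ⟨y, -, rfl⟩
    · exact ⟨0, ⟨y, hy⟩, by simp⟩
    · exact ⟨1, y, by rw [pow_one, div_mul_cancel₀ _ hx0]⟩
  | zero => exact ⟨0, 0, by simp⟩
  | one => exact ⟨0, 1, by simp⟩
  | add a b _ _ ha hb =>
    obtain ⟨M, r, hr⟩ := ha
    obtain ⟨N, r', hr'⟩ := hb
    refine ⟨M + N, r * ⟨x, hxR⟩ ^ N + r' * ⟨x, hxR⟩ ^ M, ?_⟩
    simp only [Subring.coe_add, Subring.coe_mul, Subring.coe_pow]
    rw [← hr, ← hr']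
    ring
  | neg a _ ha =>
    obtain ⟨M, r, hr⟩ := ha
    exact ⟨M, -r, by rw [Subring.coe_neg, ← hr]; ring⟩
  | mul a b _ _ ha hb =>
    obtain ⟨M, r, hr⟩ := ha
    obtain ⟨N, r', hr'⟩ := hb
    refine ⟨M + N, r * r', ?_⟩
    rw [Subring.coe_mul, ← hr, ← hr']
    ring

/-- **A local blowing up is an isomorphism off the exceptional prime.** Let `R'` be the local blowing up of `R` along `P` with
respect to `O`, `x` an exceptional parameter along `P` (so `x ∈ R'`), and `Q₁` a prime of `R'` NOT containing `x`. Then the local ring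
`(R')_{Q₁} ⊆ K` (given by its `locChar` `hD`) is the local ring of `R` at `Q₁ ∩ R`: every element of `(R')_{Q₁}` is a fraction of
elements of `R` with denominator outside `Q₁` (chart elements are `γ / x^N` and `x` is a unit at `Q₁`; value-one denominators of `R'`
are units). [cite: Cutkosky2014, §2.1] [cite: NovacoskiSpivakovsky2014, Def. 2.11] -/
theorem locChar_eq_of_not_mem_excPrime (hbl : IsLocalBlowupAlong O R P R') {x : K}
    (hx : (∃ hxR : x ∈ R, (⟨x, hxR⟩ : R) ∈ P) ∧ x ≠ 0 ∧ ∀ y : R, y ∈ P → O.valuation (y : K) ≤ O.valuation x)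
    (hle : R ≤ R') {Q₁ : Ideal R'} [hQ₁ : Q₁.IsPrime] (hxQ : (⟨x, hle hx.1.fst⟩ : R') ∉ Q₁)
    {D : Subring K} (hD : ∀ z : K, z ∈ D ↔ ∃ a b : R', b ∉ Q₁ ∧ z = (a : K) / b) :
    ∀ z : K, z ∈ D ↔ ∃ a b : R, b ∉ Q₁.comap (Subring.inclusion hle) ∧ z = (a : K) / b := by
  classical
  have hxR : x ∈ R := hx.1.fst
  have hx0 : x ≠ 0 := hx.2.1
  have hR' := eq_locAtCentre_chart_of_excParam hbl hx
  set C := Subring.closure ((R : Set K) ∪ (fun y : R => (y : K) / x) '' (P : Set R)) with hCdef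
  have hCR' : C ≤ R' := hR' ▸ le_locAtCentre C O
  -- powers of `x` are outside `Q₁`
  have hxpow : ∀ N : ℕ, (⟨x, hle hxR⟩ : R') ^ N ∉ Q₁ := fun N h => hxQ (hQ₁.mem_of_pow_mem N h)
  intro z
  constructor
  · intro hz
    obtain ⟨a, b, hb, rfl⟩ := (hD z).mp hz
    -- `a = c₁ / c₂`, `b = d₁ / d₂` with `cᵢ, dᵢ ∈ C`, `c₂, d₂` of value one (units of `R'`)
    have ha' : (a : K) ∈ locAtCentre C O := hR' ▸ a.2
    have hb' : (b : K) ∈ locAtCentre C O := hR' ▸ b.2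
    obtain ⟨c₁, hc₁, c₂, hc₂, hvc₂, hac⟩ := mem_locAtCentre_iff.mp ha'
    obtain ⟨d₁, hd₁, d₂, hd₂, hvd₂, hbd⟩ := mem_locAtCentre_iff.mp hb'
    have hc₂0 : c₂ ≠ 0 := ne_zero_of_valuation_eq_one hvc₂
    have hd₂0 : d₂ ≠ 0 := ne_zero_of_valuation_eq_one hvd₂
    -- bounded denominators
    obtain ⟨N₁, r₁, hr₁⟩ := exists_pow_mul_mem_of_mem_chart (P := P) hxR (C.mul_mem hc₁ hd₂)
    obtain ⟨N₂, r₂, hr₂⟩ := exists_pow_mul_mem_of_mem_chart (P := P) hxR (C.mul_mem hc₂ hd₁)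
    -- the denominator `c₂ d₁ x^{N₂} x^{N₁} = r₂ x^{N₁}` is outside `Q₁`
    have hc₂u : c₂⁻¹ ∈ R' := by
      have := inv_mem_locAtCentre (le_locAtCentre C O hc₂) hvc₂
      rwa [← hR'] at this
    have hd₂R' : d₂ ∈ R' := hCR' hd₂
    have hd₁R' : d₁ ∈ R' := hCR' hd₁
    have hc₂R' : c₂ ∈ R' := hCR' hc₂
    have hc₂Q : (⟨c₂, hc₂R'⟩ : R') ∉ Q₁ := by
      intro h
      have hu : IsUnit (⟨c₂, hc₂R'⟩ : R') := (isUnit_subring_iff_inv_mem _).mpr ⟨hc₂0, hc₂u⟩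
      exact hQ₁.ne_top (Q₁.eq_top_of_isUnit_mem h hu)
    have hd₁Q : (⟨d₁, hd₁R'⟩ : R') ∉ Q₁ := by
      intro h
      apply hb
      have hbeq : b = ⟨d₁, hd₁R'⟩ * ⟨d₂⁻¹, by
          have := inv_mem_locAtCentre (le_locAtCentre C O hd₂) hvd₂
          rwa [← hR'] at this⟩ := by
        apply Subtype.ext
        change (b : K) = d₁ * d₂⁻¹
        rw [hbd, div_eq_mul_inv]
      rw [hbeq]
      exact Q₁.mul_mem_right _ h
    have hden : (⟨(r₂ : K) * x ^ N₁, R'.mul_mem (hle r₂.2) (R'.pow_mem (hle hxR) N₁)⟩ : R') ∉ Q₁ := by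
      have heq : (⟨(r₂ : K) * x ^ N₁, R'.mul_mem (hle r₂.2) (R'.pow_mem (hle hxR) N₁)⟩ : R') =
          ⟨c₂, hc₂R'⟩ * ⟨d₁, hd₁R'⟩ * (⟨x, hle hxR⟩ : R') ^ N₂ * (⟨x, hle hxR⟩ : R') ^ N₁ := by
        apply Subtype.ext
        simp only [Subring.coe_mul, Subring.coe_pow]
        rw [← hr₂]
      rw [heq]
      intro h
      rcases hQ₁.mem_or_mem h with h | h
      · rcases hQ₁.mem_or_mem h with h | h
        · rcases hQ₁.mem_or_mem h with h | h
          · exact hc₂Q h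
          · exact hd₁Q h
        · exact hxpow N₂ h
      · exact hxpow N₁ h
    refine ⟨r₁ * ⟨x, hxR⟩ ^ N₂, r₂ * ⟨x, hxR⟩ ^ N₁, ?_, ?_⟩
    · rw [Ideal.mem_comap]
      exact fun h => hden (by
        have : Subring.inclusion hle (r₂ * ⟨x, hxR⟩ ^ N₁) =
            ⟨(r₂ : K) * x ^ N₁, R'.mul_mem (hle r₂.2) (R'.pow_mem (hle hxR) N₁)⟩ := Subtype.ext rfl
        rwa [this] at h)
    · simp only [Subring.coe_mul, Subring.coe_pow]
      rw [← hr₁, ← hr₂, hac, hbd]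
      have hxN : x ^ N₁ ≠ 0 := pow_ne_zero _ hx0
      have hxM : x ^ N₂ ≠ 0 := pow_ne_zero _ hx0
      have hd₁0 : d₁ ≠ 0 := by
        intro h
        apply hd₁Q
        have : (⟨d₁, hd₁R'⟩ : R') = 0 := Subtype.ext (by simp [h])
        rw [this]
        exact Q₁.zero_mem
      field_simp
  · rintro ⟨a, b, hb, rfl⟩
    rw [Ideal.mem_comap] at hb
    exact (hD _).mpr ⟨Subring.inclusion hle a, Subring.inclusion hle b, hb, rfl⟩

end OffExceptional

end Summit.ResolutionOfSingularities.ResolutionOfSingularities.Theorems.SwitchingDichotomy.StrippedThread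

end
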